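import Mathlib
import HarnessLib
import Literature.GroupTheory.CombinatorialGroupTheory.SignedHurwitzAction

/-!
# Stub `stub_sortBiSpan` of line `modp-braid-orbits` for crux `ConvexBisection.AcyclicBisectionExists`
(item stmt-SmoothPoincare4-10508, route route-SmoothPoincare4-ConvexBisection)

Pure linear algebra over a field `K` for the signed Hurwitz action
(`Literature.GroupTheory.CombinatorialGroupTheory.SignedHurwitzAction`) on words in
`V = K^g ⊕ K^g` with the standard symplectic form `B = stdSymp K g`.

**Statement.** Let `l` be a signed word with `4g` letters, `2g` of them positive, and trivial
monodromy `wordProduct B l = 1`, and let `m` be a word in the Hurwitz orbit of `l` whose positive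
classes span `V`.  Then the orbit of `l` contains a *sorted* word `m'` (positive letters first)
whose positive classes span `V` and whose negative classes span `V` as well.

**Proof.**
* §General (any alternating pairing `B` on a `K`-space): the two Hurwitz identities
  `T_{T_a b} T_a = T_a T_b`, `T_b T_{T_b⁻¹ a} = T_a T_b` give invariance of length, number of
  positive letters and monodromy along the orbit; Hurwitz moves inside a tail lift to the whole
  word; a letter can be bubbled to the right through a block by inverse moves without touching the
  block (`bubble`), whence every word can be sorted inside its orbit keeping its positive letters
  verbatim (`exists_sorted`); telescoping `T_Q x - x ∈ span (classes of Q)`; if the classes of `Q`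
  are linearly independent and `T_Q x = x` then `x ⊥ Q` (`orth_of_fixed`); and the second-basis
  lemma `span_eq_top_of_mul_eq_one`: if the classes of `P` form a basis, `B` is nondegenerate and
  `T_P T_N = 1`, then `T_P - 1` is injective hence onto, `T_N` is onto, and every vector
  `(T_P - 1)(T_N w) = -(T_N w - w)` lies in the span of the classes of `N`.
* §Standard: the closed formula for `stdSymp`, which is alternating and nondegenerate.
* The stub: sort `m` by `exists_sorted`, read off `|P| = 2g = dim V` from the invariants, so the
  spanning positive classes form a basis, and apply the second-basis lemma.
-/

noncomputable section

-- the prescribed namespace `Summit.<P>.<Sub>.…` duplicates `SmoothPoincare4` (P = Sub)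
set_option linter.dupNamespace false

namespace Summit.SmoothPoincare4.SmoothPoincare4.Theorems.AcyclicBisectionExists.ModpBraidOrbits

open Literature.GroupTheory.CombinatorialGroupTheory.SignedHurwitz

namespace SortBiSpan

section General

variable {K : Type*} [Field K] {V : Type*} [AddCommGroup V] [Module K V]
  (B : V →ₗ[K] V →ₗ[K] K)

/-- An alternating pairing is skew. -/
theorem skew_of_alt (hB : ∀ x, B x x = 0) (x y : V) : B x y = -B y x := by
  have h := hB (x + y)
  simp only [map_add, LinearMap.add_apply, hB, zero_add, add_zero] at h
  linear_combination h

/-- First Hurwitz identity `T_{T_a b} T_a = T_a T_b` (with a trailing factor `W`). -/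
theorem hurwitz_mul₁ (hB : ∀ x, B x x = 0) (a : V) (sa : Bool) (b : V) (sb : Bool)
    (W : Module.End K V) :
    transvection B (b + (sgn sa * B a b) • a, sb) * (transvection B (a, sa) * W) =
      transvection B (a, sa) * (transvection B (b, sb) * W) := by
  ext y
  simp only [Module.End.mul_apply, transvection_apply, map_add, map_smul, LinearMap.add_apply,
    LinearMap.smul_apply, smul_eq_mul, hB, skew_of_alt B hB b a]
  module

/-- Second Hurwitz identity `T_b T_{T_b⁻¹ a} = T_a T_b` (with a trailing factor `W`). -/
theorem hurwitz_mul₂ (hB : ∀ x, B x x = 0) (a : V) (sa : Bool) (b : V) (sb : Bool)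
    (W : Module.End K V) :
    transvection B (b, sb) * (transvection B (a - (sgn sb * B b a) • b, sa) * W) =
      transvection B (a, sa) * (transvection B (b, sb) * W) := by
  ext y
  simp only [Module.End.mul_apply, transvection_apply, map_add, map_smul, map_sub,
    LinearMap.smul_apply, LinearMap.sub_apply, smul_eq_mul, hB, skew_of_alt B hB b a]
  module

/-- Invariants of one Hurwitz step: length, number of positive letters, monodromy. -/
theorem step_invariants (hB : ∀ x, B x x = 0) {l l' : List (V × Bool)} (h : HurwitzStep B l l') :
    l'.length = l.length ∧ (l'.filter (·.2)).length = (l.filter (·.2)).length ∧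
      wordProduct B l' = wordProduct B l := by
  obtain ⟨pre, suf, ⟨a, sa⟩, ⟨b, sb⟩, rfl, rfl | rfl⟩ := h
  · refine ⟨by simp, ?_, ?_⟩
    · cases sa <;> cases sb <;> simp [List.filter_append]
    · simp only [wordProduct_append, wordProduct_cons, hurwitz_mul₁ B hB]
  · refine ⟨by simp, ?_, ?_⟩
    · cases sa <;> cases sb <;> simp [List.filter_append]
    · simp only [wordProduct_append, wordProduct_cons, hurwitz_mul₂ B hB]

/-- Invariants along a Hurwitz orbit. -/
theorem orbit_invariants (hB : ∀ x, B x x = 0) {l l' : List (V × Bool)} (h : HurwitzOrbit B l l') :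
    l'.length = l.length ∧ (l'.filter (·.2)).length = (l.filter (·.2)).length ∧
      wordProduct B l' = wordProduct B l := by
  induction h with
  | refl => exact ⟨rfl, rfl, rfl⟩
  | tail _ hst ih =>
    obtain ⟨h₁, h₂, h₃⟩ := step_invariants B hB hst
    exact ⟨h₁.trans ih.1, h₂.trans ih.2.1, h₃.trans ih.2.2⟩

/-- A Hurwitz step inside the tail. -/
theorem step_cons {l l' : List (V × Bool)} (h : HurwitzStep B l l') (q : V × Bool) :
    HurwitzStep B (q :: l) (q :: l') := by
  obtain ⟨pre, suf, a, b, rfl, h⟩ := h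
  exact ⟨q :: pre, suf, a, b, rfl, h.imp (congrArg _) (congrArg _)⟩

/-- A Hurwitz orbit inside the tail. -/
theorem orbit_cons {l l' : List (V × Bool)} (h : HurwitzOrbit B l l') (q : V × Bool) :
    HurwitzOrbit B (q :: l) (q :: l') := by
  induction h with
  | refl => exact HurwitzOrbit.refl B _
  | tail _ hst ih => exact ih.trans (step_cons B hst q).orbit

/-- Bubbling a letter through a block `P`, keeping the classes of `P`. -/
theorem bubble (P N : List (V × Bool)) (x : V × Bool) :
    ∃ x' : V × Bool, x'.2 = x.2 ∧ HurwitzOrbit B (x :: (P ++ N)) (P ++ x' :: N) := by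
  induction P generalizing x with
  | nil => exact ⟨x, rfl, HurwitzOrbit.refl B _⟩
  | cons q P ih =>
    obtain ⟨x', hx', h⟩ := ih (x.1 - (sgn q.2 * B q.1 x.1) • q.1, x.2)
    have hstep : HurwitzStep B (x :: q :: (P ++ N))
        (q :: (x.1 - (sgn q.2 * B q.1 x.1) • q.1, x.2) :: (P ++ N)) :=
      ⟨[], P ++ N, x, q, rfl, Or.inr rfl⟩
    exact ⟨x', hx', hstep.orbit.trans (orbit_cons B h q)⟩

/-- Sorting inside the orbit, keeping the positive letters. -/
theorem exists_sorted (w : List (V × Bool)) :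
    ∃ P N : List (V × Bool), HurwitzOrbit B w (P ++ N) ∧ (∀ x ∈ P, x.2 = true) ∧
      (∀ x ∈ N, x.2 = false) ∧ ∀ y ∈ w, y.2 = true → y ∈ P := by
  induction w with
  | nil => exact ⟨[], [], HurwitzOrbit.refl B _, by simp, by simp, by simp⟩
  | cons x w ih =>
    obtain ⟨P, N, hO, hP, hN, hcl⟩ := ih
    have hO' : HurwitzOrbit B (x :: w) (x :: (P ++ N)) := orbit_cons B hO x
    cases hx : x.2 with
    | true =>
      exact ⟨x :: P, N, hO', List.forall_mem_cons.mpr ⟨hx, hP⟩, hN, List.forall_mem_cons.mpr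
        ⟨fun _ => List.mem_cons_self, fun y hy h2 => List.mem_cons_of_mem _ (hcl y hy h2)⟩⟩
    | false =>
      obtain ⟨x', hx', hb⟩ := bubble B P N x
      exact ⟨P, x' :: N, hO'.trans hb, hP, List.forall_mem_cons.mpr ⟨hx'.trans hx, hN⟩,
        List.forall_mem_cons.mpr ⟨fun h2 => absurd (hx.symm.trans h2) Bool.false_ne_true, hcl⟩⟩

/-- Telescoping: `T_Q x - x` lies in the span of any set containing the classes of `Q`. -/
theorem wordProduct_apply_sub_mem (S : Set V) :
    ∀ Q : List (V × Bool), (∀ q ∈ Q, q.1 ∈ S) → ∀ x : V,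
      wordProduct B Q x - x ∈ Submodule.span K S
  | [], _, x => by simp
  | q :: Q, hQ, x => by
    obtain ⟨hq, hQ'⟩ := List.forall_mem_cons.mp hQ
    rw [wordProduct_cons, Module.End.mul_apply, transvection_apply]
    convert add_mem (wordProduct_apply_sub_mem S Q hQ' x) (Submodule.smul_mem _
      (sgn q.2 * B q.1 (wordProduct B Q x)) (Submodule.subset_span hq)) using 1
    abel

/-- `sgn b` squares to `1`. -/
theorem sgn_mul_sgn (b : Bool) : (sgn b : K) * sgn b = 1 := by
  cases b <;> simp

/-- If the classes of `Q` are linearly independent and `T_Q` fixes `x`, then `x` is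
`B`-orthogonal to every class of `Q` (peel off the first letter: its coefficient must vanish). -/
theorem orth_of_fixed (x : V) :
    ∀ Q : List (V × Bool), LinearIndependent K (fun i : Fin Q.length => (Q.get i).1) →
      wordProduct B Q x = x → ∀ q ∈ Q, B q.1 x = 0
  | [], _, _ => by simp
  | q :: Q, hli, hfix => by
    obtain ⟨hli', hq⟩ := linearIndependent_finSucc.mp hli
    have hrange : ∀ q' ∈ Q, q'.1 ∈
        Set.range (Fin.tail fun i : Fin (Q.length + 1) => ((q :: Q).get i).1) := by
      intro q' hq'
      obtain ⟨i, rfl⟩ := List.get_of_mem hq'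
      exact ⟨i, rfl⟩
    rw [wordProduct_cons, Module.End.mul_apply, transvection_apply] at hfix
    have hmem := wordProduct_apply_sub_mem B _ Q hrange x
    set y := wordProduct B Q x
    have hc0 : sgn q.2 * B q.1 y = 0 := by
      by_contra hne
      apply hq
      have h1 : (sgn q.2 * B q.1 y) • q.1 = -(y - x) := by rw [← hfix]; abel
      exact (Submodule.smul_mem_iff _ hne).mp (h1 ▸ neg_mem hmem)
    have hyx : y = x := by simpa [hc0] using hfix
    refine List.forall_mem_cons.mpr ⟨?_, orth_of_fixed x Q hli' hyx⟩
    calc B q.1 x = sgn q.2 * (sgn q.2 * B q.1 y) := by rw [← mul_assoc, sgn_mul_sgn, one_mul, hyx]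
      _ = 0 := by rw [hc0, mul_zero]

/-- The second basis: if the classes of `P` form a basis, `B` is nondegenerate and
`T_P * T_N = 1`, then the classes of `N` span (`T_P - 1` is injective hence onto, and
`T_N - 1 = (1 - T_P) T_N` up to sign has range in the span of the classes of `N`). -/
theorem span_eq_top_of_mul_eq_one [FiniteDimensional K V] (hnd : ∀ x, (∀ v, B v x = 0) → x = 0)
    (P N : List (V × Bool)) (hli : LinearIndependent K (fun i : Fin P.length => (P.get i).1))
    (hsp : Submodule.span K (Set.range fun i : Fin P.length => (P.get i).1) = ⊤)
    (hprod : wordProduct B P * wordProduct B N = 1) (S : Set V) (hS : ∀ q ∈ N, q.1 ∈ S) :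
    Submodule.span K S = ⊤ := by
  have hinj : Function.Injective (wordProduct B P - 1 : Module.End K V) := by
    refine (injective_iff_map_eq_zero _).mpr fun x hx => hnd x ?_
    have hfix : wordProduct B P x = x := by
      simpa [LinearMap.sub_apply, sub_eq_zero] using hx
    have hzero : B.flip x = 0 :=
      LinearMap.ext_on_range hsp fun i => by
        simpa using orth_of_fixed B x P hli hfix _ (List.get_mem P i)
    intro v
    simpa using LinearMap.congr_fun hzero v
  have hsurj : Function.Surjective (wordProduct B P - 1 : Module.End K V) :=
    LinearMap.injective_iff_surjective.mp hinj
  have hinjN : Function.Injective (wordProduct B N) := by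
    intro x y hxy
    simpa [← Module.End.mul_apply, hprod] using congrArg (wordProduct B P) hxy
  have hsurjN : Function.Surjective (wordProduct B N) :=
    LinearMap.injective_iff_surjective.mp hinjN
  rw [eq_top_iff]
  rintro z -
  obtain ⟨y, rfl⟩ := hsurj z
  obtain ⟨w, rfl⟩ := hsurjN y
  have h : (wordProduct B P - 1) (wordProduct B N w) = -(wordProduct B N w - w) := by
    rw [LinearMap.sub_apply, Module.End.one_apply, ← Module.End.mul_apply, hprod,
      Module.End.one_apply, neg_sub]
  exact h ▸ neg_mem (wordProduct_apply_sub_mem B S N hS w)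

end General

section Standard

variable {K : Type*} [Field K]

/-- Closed formula for the standard symplectic form: `B x y = ∑ i (x_i y_{g+i} - x_{g+i} y_i)`. -/
theorem stdSymp_apply (g : ℕ) (x y : Fin g ⊕ Fin g → K) :
    stdSymp K g x y = ∑ i, (x (Sum.inl i) * y (Sum.inr i) - x (Sum.inr i) * y (Sum.inl i)) := by
  rw [Finset.sum_sub_distrib]
  simp [stdSymp, Matrix.toLinearMap₂'_apply, Fintype.sum_sum_type, Matrix.one_apply, sub_eq_add_neg]

/-- The standard symplectic form is alternating. -/
theorem stdSymp_self (g : ℕ) (x : Fin g ⊕ Fin g → K) : stdSymp K g x x = 0 := by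
  simp [stdSymp_apply, mul_comm]

/-- The standard symplectic form is nondegenerate (test against the coordinate vectors). -/
theorem stdSymp_nondeg (g : ℕ) (x : Fin g ⊕ Fin g → K) (h : ∀ v, stdSymp K g v x = 0) : x = 0 := by
  funext j
  rcases j with i | i
  · have := h (Pi.single (Sum.inr i) 1)
    simpa [stdSymp_apply, Pi.single_apply] using this
  · have := h (Pi.single (Sum.inl i) 1)
    simpa [stdSymp_apply, Pi.single_apply] using this

end Standard

end SortBiSpan

/-- **Stub `stub_sortBiSpan`**: an element `m` of the signed Hurwitz orbit of a word `l` of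
`4g` letters, `2g` of them positive, with trivial monodromy for the standard symplectic form on
`K^{2g}`, whose positive classes span, can be replaced by a SORTED orbit element `m'` (positive
letters first) whose positive classes still span and whose negative classes span as well.
Proof: bubble every negative letter of `m` to the right through the positive ones by inverse
Hurwitz moves (this keeps the positive letters verbatim, so their classes still span); writing
`m' = P ++ N`, the `2g = dim` positive classes form a basis, `T_P x = x` forces `x ⊥ P` hence
`x = 0` (nondegeneracy), so `T_P - 1` is onto; as `T_P T_N = T_{m'} = T_l = 1`, every vector is
`(T_P - 1)(T_N w) = -(T_N w - w)`, which lies in the span of the classes of `N`. [folklore] -/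
theorem stub_sortBiSpan :
    ∀ (K : Type) [Field K] (g : ℕ) (l m : List ((Fin g ⊕ Fin g → K) × Bool)),
      l.length = 4 * g → (l.filter (·.2)).length = 2 * g →
      wordProduct (stdSymp K g) l = 1 →
      HurwitzOrbit (stdSymp K g) l m → Submodule.span K (classesOfSign m true) = ⊤ →
      ∃ m' : List ((Fin g ⊕ Fin g → K) × Bool),
        HurwitzOrbit (stdSymp K g) l m' ∧ Sorted m' ∧
        Submodule.span K (classesOfSign m' true) = ⊤ ∧
        Submodule.span K (classesOfSign m' false) = ⊤ := by
  intro K _ g l m _ hpos hprod hlm hspan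
  have hB : ∀ x, stdSymp K g x x = 0 := SortBiSpan.stdSymp_self g
  obtain ⟨P, N, hO, hP, hN, hcl⟩ := SortBiSpan.exists_sorted (stdSymp K g) m
  have hO' : HurwitzOrbit (stdSymp K g) l (P ++ N) := hlm.trans hO
  obtain ⟨-, hpos', hprod'⟩ := SortBiSpan.orbit_invariants (stdSymp K g) hB hO'
  rw [hpos, List.filter_append, List.filter_eq_self.mpr (by simpa using hP),
    List.filter_eq_nil_iff.mpr (by simpa using hN), List.append_nil] at hpos'
  rw [hprod, wordProduct_append] at hprod'
  have hsub : classesOfSign m true ⊆ Set.range (fun i : Fin P.length => (P.get i).1) := by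
    intro v hv
    obtain ⟨i, hi⟩ := List.get_of_mem (hcl (v, true) hv rfl)
    exact ⟨i, congrArg Prod.fst hi⟩
  have hsp : Submodule.span K (Set.range fun i : Fin P.length => (P.get i).1) = ⊤ :=
    top_unique (hspan ▸ Submodule.span_mono hsub)
  have hli : LinearIndependent K (fun i : Fin P.length => (P.get i).1) :=
    linearIndependent_of_top_le_span_of_card_eq_finrank hsp.ge
      (by rw [Fintype.card_fin, hpos', Module.finrank_fintype_fun_eq_card, Fintype.card_sum,
        Fintype.card_fin, two_mul])
  refine ⟨P ++ N, hO', ⟨P, N, rfl, hP, hN⟩, ?_, ?_⟩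
  · exact top_unique (hspan ▸ Submodule.span_mono fun v hv =>
      List.mem_append_left N (hcl (v, true) hv rfl))
  · refine SortBiSpan.span_eq_top_of_mul_eq_one (stdSymp K g) (SortBiSpan.stdSymp_nondeg g) P N
      hli hsp hprod' _ ?_
    intro q hq
    show (q.1, false) ∈ P ++ N
    rw [← hN q hq]
    exact List.mem_append_right P hq

end Summit.SmoothPoincare4.SmoothPoincare4.Theorems.AcyclicBisectionExists.ModpBraidOrbits

end
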